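import Mathlib
import Summits.MatrixMultiplication.MatrixMultiplication.Theses.GLnSeparatingDesigns
import Summits.MatrixMultiplication.MatrixMultiplication.Theorems.BorderHalfDimensionDesigns.Negative.CountingBarrier
import Summits.MatrixMultiplication.MatrixMultiplication.Theorems.BorderHalfDimensionDesigns.Negative.AffineSubfamilyBounds

/-!
# The trivial-exponent law `(|X||Y||Z|)² ≤ ((s+1)^(n²))³` for GL_n designs with degree-`s` separators

Stub `stub_volume_sq_le_counting` of line `Ideate5Sketch` (crux `BorderHalfDimensionDesigns`, item
stmt-MatrixMultiplication-18360, route `GLnSeparatingDesigns`).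

For EVERY finite `X, Y, Z ⊆ GL_n(ℂ)` carrying, for every target `(x₀, z₀)`, an `η`-approximate separator of
total degree `≤ s` (value within `η` of `[x = x₀ ∧ y = y' ∧ z = z₀]` at the sampled point `x y⁻¹ y' z⁻¹`),
with `η` below each of `1/(|X||Z|)`, `1/(|X||Y|)`, `1/(|Y||Z|)`, the three pairwise counts
`|X||Z|, |X||Y|, |Y||Z| ≤ (s+1)^(n²)` hold, hence `(|X||Y||Z|)² ≤ ((s+1)^(n²))³`.  No TPP is assumed.

* `|X||Z|` is the tree's `BorderHalfDimensionDesignsNeg.card_mul_card_le_of_separators`.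
* `|X||Y|` (resp. `|Y||Z|`): indexed by `(x₁, y₁) ∈ X × Y` (resp. `(y₁, z₁) ∈ Y × Z`) the values
  `p_{x₁ z₀}(x y⁻¹ · y₁ z₀⁻¹)` (resp. `p_{x₀ z₁}(x₀ y₁⁻¹ · y' z⁻¹)`) form an `η`-approximate dual family; after
  substituting the linear forms "entries of `L · M · R`" (`L, R` constant per row) into `p` the degree stays
  `≤ s` (`totalDegree_bind₁_le_of_affine`), so every row lies in the span of the `≤ (s+1)^(n²)` monomial
  functions of exponents `≤ s` in the entries of `M = x y⁻¹` (resp. `y' z⁻¹`), and the engine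
  `card_le_finrank_of_approx_dual` bounds the index set by that dimension
  (`volumeCount_card_le_of_twoSided_eval`).
-/

set_option linter.dupNamespace false

open scoped BigOperators Matrix

namespace Summit.MatrixMultiplication.MatrixMultiplication.Theorems.BorderHalfDimensionDesigns

/-- **Two-sided translated approximate dual families are small.** If the functions
`j ↦ p_i(L_i · M_j · R_i)` (`p_i` of total degree `≤ s` in the `n²` entries, `L_i, R_i` constant along the
row) form an `η`-approximate dual family on a finite index type `ι` with `η · #ι < 1`, then
`#ι ≤ (s+1)^(n²)`: substituting the linear forms "entries of `L_i M R_i`" keeps the degree `≤ s`, so every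
row lies in the span of the `(s+1)^(n²)` monomial functions of exponents `≤ s` in the entries of `M_j`.
[folklore] -/
theorem volumeCount_card_le_of_twoSided_eval {n s : ℕ} {ι : Type*} [Fintype ι]
    (F : ι → ι → Matrix (Fin n) (Fin n) ℂ) (L R M : ι → Matrix (Fin n) (Fin n) ℂ)
    (hF : ∀ i j, F i j = L i * M j * R i)
    (p : ι → MvPolynomial (Fin n × Fin n) ℂ) (hp : ∀ i, (p i).totalDegree ≤ s)
    (η : ℝ) (hη : η * Fintype.card ι < 1)
    (hdiag : ∀ i, ‖MvPolynomial.eval (fun ab : Fin n × Fin n => F i i ab.1 ab.2) (p i) - 1‖ ≤ η)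
    (hoff : ∀ i j, i ≠ j →
      ‖MvPolynomial.eval (fun ab : Fin n × Fin n => F i j ab.1 ab.2) (p i)‖ ≤ η) :
    Fintype.card ι ≤ (s + 1) ^ (n * n) := by
  classical
  -- the linear forms "entries of `L i * M * R i`" in the entries of `M`
  set ℓ : ι → Fin n × Fin n → MvPolynomial (Fin n × Fin n) ℂ := fun i ab =>
    ∑ l, (∑ k, MvPolynomial.C (L i ab.1 k) * MvPolynomial.X (k, l)) * MvPolynomial.C (R i l ab.2)
    with hℓ
  have hℓdeg : ∀ i ab, (ℓ i ab).totalDegree ≤ 1 := by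
    intro i ab
    refine MvPolynomial.totalDegree_finsetSum_le fun l _ => ?_
    refine (MvPolynomial.totalDegree_mul _ _).trans ?_
    rw [MvPolynomial.totalDegree_C, add_zero]
    refine MvPolynomial.totalDegree_finsetSum_le fun k _ => ?_
    refine (MvPolynomial.totalDegree_mul _ _).trans ?_
    rw [MvPolynomial.totalDegree_C, MvPolynomial.totalDegree_X, zero_add]
  have hPt : ∀ i j, (fun ab : Fin n × Fin n => F i j ab.1 ab.2)
      = fun ab => MvPolynomial.eval (fun kl : Fin n × Fin n => M j kl.1 kl.2) (ℓ i ab) := by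
    intro i j; funext ab
    rw [hF i j, Matrix.mul_apply]
    simp only [hℓ, map_sum, map_mul, MvPolynomial.eval_C, MvPolynomial.eval_X, Matrix.mul_apply]
  set f : ι → ι → ℂ := fun i j =>
    MvPolynomial.eval (fun ab : Fin n × Fin n => F i j ab.1 ab.2) (p i) with hf
  set mono : (Fin n × Fin n → Fin (s + 1)) → (ι → ℂ) :=
    fun μ j => ∏ kl, (M j kl.1 kl.2) ^ (μ kl : ℕ) with hmono
  set W : Submodule ℂ (ι → ℂ) := Submodule.span ℂ (Set.range mono) with hW
  have hWle : Module.finrank ℂ W ≤ (s + 1) ^ (n * n) := by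
    have h := finrank_range_le_card (R := ℂ) mono
    simpa [W, Set.finrank, Fintype.card_fun, Fintype.card_prod, Fintype.card_fin] using h
  have hfW : ∀ i, f i ∈ W := by
    intro i
    set Q := MvPolynomial.bind₁ (ℓ i) (p i) with hQ
    have hQdeg : Q.totalDegree ≤ s :=
      (BorderHalfDimensionDesignsNeg.totalDegree_bind₁_le_of_affine (ℓ i) (hℓdeg i) _).trans (hp i)
    have hexp : f i = ∑ d ∈ Q.support, (MvPolynomial.coeff d Q) •
        (fun j => ∏ kl : Fin n × Fin n, M j kl.1 kl.2 ^ d kl) := by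
      funext j
      simp only [f, Finset.sum_apply, Pi.smul_apply, smul_eq_mul]
      rw [hPt i j, show MvPolynomial.eval
            (fun ab => MvPolynomial.eval (fun kl : Fin n × Fin n => M j kl.1 kl.2) (ℓ i ab)) (p i)
          = MvPolynomial.eval (fun kl : Fin n × Fin n => M j kl.1 kl.2) Q from
            (MvPolynomial.eval₂Hom_bind₁ _ _ _ _).symm,
        MvPolynomial.eval_eq]
      refine Finset.sum_congr rfl fun d _ => ?_
      congr 1
      exact Finset.prod_subset (Finset.subset_univ _)
        (fun kl _ hkl => by rw [Finsupp.notMem_support_iff.mp hkl, pow_zero])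
    rw [hexp]
    refine Submodule.sum_mem _ fun d hd => Submodule.smul_mem _ _ (Submodule.subset_span ?_)
    refine ⟨fun kl => ⟨d kl, Nat.lt_succ_of_le
      ((BorderHalfDimensionDesignsNeg.apply_le_totalDegree hd kl).trans hQdeg)⟩, ?_⟩
    funext j
    simp [mono]
  have key := BorderHalfDimensionDesignsNeg.card_le_finrank_of_approx_dual W f hfW η hη
    (fun i => hdiag i) (fun i j hij => hoff i j hij)
  exact key.trans hWle

/-- **The trivial-exponent law.** For every finite `X, Y, Z ⊆ GL_n(ℂ)` with `η`-separators of degree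
`≤ s` for every target and `η` below each pairwise product, the three pairwise counts
`|X||Z|, |X||Y|, |Y||Z| ≤ (s+1)^(n²)` (approximate dual bases inside the span of the monomial functions of
exponents `≤ s`, after a right/left translation of the separators) multiply to
`(|X||Y||Z|)² ≤ ((s+1)^(n²))³`.  No TPP assumed. [folklore] -/
theorem stub_volume_sq_le_counting {n s : ℕ} {X Y Z : Finset (Matrix.GeneralLinearGroup (Fin n) ℂ)} {η : ℝ}
    (hsep : ∀ x₀ ∈ X, ∀ z₀ ∈ Z, ∃ p : MvPolynomial (Fin n × Fin n) ℂ, p.totalDegree ≤ s ∧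
      ∀ x ∈ X, ∀ y ∈ Y, ∀ y' ∈ Y, ∀ z ∈ Z,
        ((x = x₀ ∧ y = y' ∧ z = z₀) → ‖MvPolynomial.eval (fun ij : Fin n × Fin n =>
          ((x * y⁻¹ * y' * z⁻¹ : Matrix.GeneralLinearGroup (Fin n) ℂ) : Matrix (Fin n) (Fin n) ℂ) ij.1 ij.2) p - 1‖ ≤ η) ∧
        (¬ (x = x₀ ∧ y = y' ∧ z = z₀) → ‖MvPolynomial.eval (fun ij : Fin n × Fin n =>
          ((x * y⁻¹ * y' * z⁻¹ : Matrix.GeneralLinearGroup (Fin n) ℂ) : Matrix (Fin n) (Fin n) ℂ) ij.1 ij.2) p‖ ≤ η))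
    (hηXZ : η * (X.card * Z.card) < 1) (hηXY : η * (X.card * Y.card) < 1) (hηYZ : η * (Y.card * Z.card) < 1) :
    (X.card * Y.card * Z.card) ^ 2 ≤ ((s + 1) ^ (n * n)) ^ 3 := by
  classical
  rcases X.eq_empty_or_nonempty with hX | ⟨x₀, hx₀⟩
  · simp [hX]
  rcases Y.eq_empty_or_nonempty with hY | ⟨y₀, hy₀⟩
  · simp [hY]
  rcases Z.eq_empty_or_nonempty with hZ | ⟨z₀, hz₀⟩
  · simp [hZ]
  -- (1) `|X||Z| ≤ (s+1)^(n²)`: the tree's two-set packing bound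
  have h1 : X.card * Z.card ≤ (s + 1) ^ (n * n) :=
    BorderHalfDimensionDesignsNeg.card_mul_card_le_of_separators ⟨y₀, hy₀⟩ hsep hηXZ
  choose p hpdeg hpsep using hsep
  -- (2) `|X||Y| ≤ (s+1)^(n²)`: rows `(x₁, y₁)`, columns `(x, y)`, value `p_{x₁ z₀}(x y⁻¹ y₁ z₀⁻¹)`
  have h2 : X.card * Y.card ≤ (s + 1) ^ (n * n) := by
    have hcard : Fintype.card (↥X × ↥Y) = X.card * Y.card := by simp
    have key := volumeCount_card_le_of_twoSided_eval (ι := ↥X × ↥Y)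
      (fun i j => ((j.1.1 * j.2.1⁻¹ * i.2.1 * z₀⁻¹ : Matrix.GeneralLinearGroup (Fin n) ℂ) :
        Matrix (Fin n) (Fin n) ℂ))
      (fun _ => 1)
      (fun i => ((i.2.1 * z₀⁻¹ : Matrix.GeneralLinearGroup (Fin n) ℂ) : Matrix (Fin n) (Fin n) ℂ))
      (fun j => ((j.1.1 * j.2.1⁻¹ : Matrix.GeneralLinearGroup (Fin n) ℂ) : Matrix (Fin n) (Fin n) ℂ))
      (fun i j => by simp only [Units.val_mul, one_mul, mul_assoc])
      (fun i => p i.1.1 i.1.2 z₀ hz₀) (fun i => hpdeg _ _ _ _) η (by rw [hcard]; push_cast; exact hηXY)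
      (fun i => (hpsep i.1.1 i.1.2 z₀ hz₀ i.1.1 i.1.2 i.2.1 i.2.2 i.2.1 i.2.2 z₀ hz₀).1 ⟨rfl, rfl, rfl⟩)
      (fun i j hij => (hpsep i.1.1 i.1.2 z₀ hz₀ j.1.1 j.1.2 j.2.1 j.2.2 i.2.1 i.2.2 z₀ hz₀).2
        (fun h => hij (Prod.ext (Subtype.ext h.1.symm) (Subtype.ext h.2.1.symm))))
    rwa [hcard] at key
  -- (3) `|Y||Z| ≤ (s+1)^(n²)`: rows `(y₁, z₁)`, columns `(y', z)`, value `p_{x₀ z₁}(x₀ y₁⁻¹ y' z⁻¹)`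
  have h3 : Y.card * Z.card ≤ (s + 1) ^ (n * n) := by
    have hcard : Fintype.card (↥Y × ↥Z) = Y.card * Z.card := by simp
    have key := volumeCount_card_le_of_twoSided_eval (ι := ↥Y × ↥Z)
      (fun i j => ((x₀ * i.1.1⁻¹ * j.1.1 * j.2.1⁻¹ : Matrix.GeneralLinearGroup (Fin n) ℂ) :
        Matrix (Fin n) (Fin n) ℂ))
      (fun i => ((x₀ * i.1.1⁻¹ : Matrix.GeneralLinearGroup (Fin n) ℂ) : Matrix (Fin n) (Fin n) ℂ))
      (fun _ => 1)
      (fun j => ((j.1.1 * j.2.1⁻¹ : Matrix.GeneralLinearGroup (Fin n) ℂ) : Matrix (Fin n) (Fin n) ℂ))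
      (fun i j => by simp only [Units.val_mul, mul_one, mul_assoc])
      (fun i => p x₀ hx₀ i.2.1 i.2.2) (fun i => hpdeg _ _ _ _) η (by rw [hcard]; push_cast; exact hηYZ)
      (fun i => (hpsep x₀ hx₀ i.2.1 i.2.2 x₀ hx₀ i.1.1 i.1.2 i.1.1 i.1.2 i.2.1 i.2.2).1 ⟨rfl, rfl, rfl⟩)
      (fun i j hij => (hpsep x₀ hx₀ i.2.1 i.2.2 x₀ hx₀ i.1.1 i.1.2 j.1.1 j.1.2 j.2.1 j.2.2).2
        (fun h => hij (Prod.ext (Subtype.ext h.2.1) (Subtype.ext h.2.2.symm))))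
    rwa [hcard] at key
  -- (4) multiply: `V² = (|X||Z|)(|X||Y|)(|Y||Z|)`
  calc (X.card * Y.card * Z.card) ^ 2
      = (X.card * Z.card) * ((X.card * Y.card) * (Y.card * Z.card)) := by ring
    _ ≤ (s + 1) ^ (n * n) * ((s + 1) ^ (n * n) * (s + 1) ^ (n * n)) :=
      Nat.mul_le_mul h1 (Nat.mul_le_mul h2 h3)
    _ = ((s + 1) ^ (n * n)) ^ 3 := by ring

end Summit.MatrixMultiplication.MatrixMultiplication.Theorems.BorderHalfDimensionDesigns
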